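import Mathlib
import HarnessLib
import Literature.Barriers.CriticalPhenomena.SubexponentialGrowthZd
import Literature.Probability.Percolation.WalkExcursionDecomposition
import Summits.CriticalPhenomena.Ising3DConformalLimit.Theses.ArmDressing

/-!
# `ArmDressing.EvenPatternDecoupling` — stub `stub_patternTransferDet` (deterministic transfer)

Support file for crux item stmt-CriticalPhenomena-16133 (line `registered`): the registered stub
`stub_patternTransferDet` of the line skeleton, proved. On box-supported bond configurations,
for a mesh `δ < δ₀(c, r, b, s)` and eventually in the volume: (a) the point pattern `EVEN(z^δ)`
forces the point arms; (b) given the point arms and uniqueness of the crossing cluster of every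
annulus (read outside the inner balls), `EVEN(z^δ)` coincides with the parity pattern `Patt` of
the crossing clusters; (c) `EVEN2 ∩ CROSS ⊆ CROSS`; (d) given the ball arms and uniqueness,
`EVEN2 ∩ CROSS` coincides with `Patt`. The walk surgery is the generic
`Literature.Probability.Percolation.reachable_points_iff_crs` / `reachable_inner_iff_crs`
(excursion decomposition of open walks at the inner balls); this file supplies the metric side
conditions on `δ₀` (lattice neighbours of an inner ball stay inside its outer ball, the lattice
approximations of the points fall into the inner balls) and unfolds the crux vocabulary.
-/

namespace Summit.CriticalPhenomena.Ising3DConformalLimit.Theorems.EvenPatternDecoupling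

open scoped Topology
open Filter Set Metric
open Literature.Probability.LatticeModels Literature.Probability.Percolation
  Literature.Barriers.CriticalPhenomena

/-- Euclidean distance in `ℝ³` is at most twice the largest coordinate distance. -/
theorem dist_euclidean_le_two_mul {p q : EuclideanSpace ℝ (Fin 3)} {η : ℝ} (hη : 0 ≤ η)
    (h : ∀ i, dist (p i) (q i) ≤ η) : dist p q ≤ 2 * η := by
  rw [EuclideanSpace.dist_eq]
  have hsum : ∑ i, dist (p i) (q i) ^ 2 ≤ (2 * η) ^ 2 := by
    calc ∑ i, dist (p i) (q i) ^ 2 ≤ ∑ _i : Fin 3, η ^ 2 :=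
          Finset.sum_le_sum fun i _ => pow_le_pow_left₀ dist_nonneg (h i) 2
      _ = 3 * η ^ 2 := by simp
      _ ≤ (2 * η) ^ 2 := by nlinarith [sq_nonneg η]
  calc √(∑ i, dist (p i) (q i) ^ 2) ≤ √((2 * η) ^ 2) := Real.sqrt_le_sqrt hsum
    _ = 2 * η := Real.sqrt_sq (by linarith)

/-- Lattice neighbours of `ℤ³` differ by at most one in every coordinate (real-cast form of
the tree's `Literature.Barriers.CriticalPhenomena.abs_sub_le_one_of_zdGraph_adj`). -/
theorem abs_cast_sub_le_one_of_zdGraph_adj {x y : Site 3} (h : (zdGraph 3).Adj x y) (k : Fin 3) :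
    |((x k : ℤ) : ℝ) - (y k : ℝ)| ≤ 1 := by
  have h1 : |x k - y k| ≤ 1 :=
    Literature.Barriers.CriticalPhenomena.abs_sub_le_one_of_zdGraph_adj h.symm k
  exact_mod_cast h1

/-- Mesh-`δ` images of lattice neighbours are within `2δ`. -/
theorem dist_mesh_le_of_adj {δ : ℝ} (hδ : 0 ≤ δ) {x y : Site 3} (h : (zdGraph 3).Adj x y) :
    dist (WithLp.toLp 2 fun i : Fin 3 => δ * (x i : ℝ))
      (WithLp.toLp 2 fun i : Fin 3 => δ * (y i : ℝ)) ≤ 2 * δ := by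
  refine dist_euclidean_le_two_mul hδ fun k => ?_
  show dist (δ * (x k : ℝ)) (δ * (y k : ℝ)) ≤ δ
  rw [Real.dist_eq, ← mul_sub, abs_mul, abs_of_nonneg hδ]
  calc δ * |((x k : ℤ) : ℝ) - (y k : ℝ)| ≤ δ * 1 :=
        mul_le_mul_of_nonneg_left (abs_cast_sub_le_one_of_zdGraph_adj h k) hδ
    _ = δ := mul_one δ

/-- The mesh-`δ` image of the lattice approximation of a point is within `2δ` of the point. -/
theorem dist_mesh_latticeApprox_le {δ : ℝ} (hδ : 0 < δ) (z : EuclideanSpace ℝ (Fin 3)) :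
    dist (WithLp.toLp 2 fun i : Fin 3 => δ * ((latticeApprox δ z i : ℤ) : ℝ)) z ≤ 2 * δ := by
  refine dist_euclidean_le_two_mul hδ.le fun k => ?_
  show dist (δ * ((latticeApprox δ z k : ℤ) : ℝ)) (z k) ≤ δ
  rw [latticeApprox_apply, Real.dist_eq, abs_le]
  have h1 : ((⌊z k / δ⌋ : ℤ) : ℝ) ≤ z k / δ := Int.floor_le _
  have h2 : z k / δ < ((⌊z k / δ⌋ : ℤ) : ℝ) + 1 := Int.lt_floor_add_one _
  rw [le_div_iff₀ hδ] at h1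
  rw [div_lt_iff₀ hδ] at h2
  constructor <;> nlinarith

/-- Metric side condition: a point within `η ≤ ε` of the inner ball `B̄(b, s)`, whose
`ε`-thickening lies in the outer ball `B(c, r)`, is outside every ball `B(c', r')` whose closure is
disjoint from `B̄(c, r)`. -/
theorem not_mem_ball_of_near_inner {X : Type*} [PseudoMetricSpace X] {p q b c c' : X}
    {s r r' ε η : ℝ} (hq : q ∈ closedBall b s) (hpq : dist p q ≤ η) (hηε : η ≤ ε)
    (hsub : cthickening ε (closedBall b s) ⊆ ball c r)
    (hdisj : Disjoint (closedBall c r) (closedBall c' r')) : p ∈ (ball c' r')ᶜ := fun hp =>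
  (Set.disjoint_left.1 hdisj)
    (ball_subset_closedBall (hsub (mem_cthickening_of_dist_le p q ε _ hq (hpq.trans hηε))))
    (ball_subset_closedBall hp)

/-- Metric side condition: a point of the inner ball `B̄(b, s) ⊆ B(c, r)` is outside every ball
`B(c', r')` whose closure is disjoint from `B̄(c, r)`. -/
theorem not_mem_ball_of_mem_inner {X : Type*} [PseudoMetricSpace X] {q b c c' : X}
    {s r r' : ℝ} (hq : q ∈ closedBall b s) (hin : closedBall b s ⊆ ball c r)
    (hdisj : Disjoint (closedBall c r) (closedBall c' r')) : q ∈ (ball c' r')ᶜ := fun hp =>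
  (Set.disjoint_left.1 hdisj) (ball_subset_closedBall (hin hq)) (ball_subset_closedBall hp)

/-- Parity patterns of two pointwise-equivalent relations agree. -/
theorem mem_iff_mem_of_forall_iff {n : ℕ} {RE RP : Fin n → Fin n → Prop}
    (h : ∀ i j, RE i j ↔ RP i j) (E : Set (Fin n → Fin n → Prop)) : RE ∈ E ↔ RP ∈ E := by
  rw [show RE = RP from funext fun i => funext fun j => propext (h i j)]

/-- Transfer of the parity pattern from the doubled index set (first halves) to `Fin n`. -/
theorem mem_even2_iff_of_forall_iff {n : ℕ} {Rf : Fin (n + n) → Fin (n + n) → Prop}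
    {RP : Fin n → Fin n → Prop} (h : ∀ i j, Rf (Fin.castAdd n i) (Fin.castAdd n j) ↔ RP i j)
    {C : Set (Fin (n + n) → Fin (n + n) → Prop)} (hC : Rf ∈ C) :
    Rf ∈ {R : Fin (n + n) → Fin (n + n) → Prop |
        ∀ i : Fin n, Even ({j : Fin n | R (Fin.castAdd n i) (Fin.castAdd n j)}.ncard)} ∩ C ↔
      RP ∈ {R : Fin n → Fin n → Prop | ∀ i, Even ({j : Fin n | R i j}.ncard)} := by
  have hset : ∀ i, {j : Fin n | Rf (Fin.castAdd n i) (Fin.castAdd n j)} = {j | RP i j} :=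
    fun i => Set.ext fun j => h i j
  simp only [Set.mem_inter_iff, Set.mem_setOf_eq, hset]
  exact ⟨fun h' => h'.1, fun h' => ⟨h', hC⟩⟩


-- lint debt by design: the registered signature carries unused `let`-binders (`μ`, `PrL`, `Pr`, …); the header
-- below is the registered stub signature = line 85 of the line skeleton with whitespace compressed (token-identical)
set_option linter.unusedVariables false in
/-- **Stub `stub_patternTransferDet` of the line skeleton of crux `EvenPatternDecoupling`
(deterministic, proved): the even pattern is read on the crossing clusters.** For outer data
`(c, r)`, an admissible inner family `(b, s)` and every mesh `δ < δ₀(c, r, b, s)`, every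
configuration `z` well inside the family, eventually in the volume `L`, and every configuration
`ω` supported on the box edges: (a) `EVEN(z^δ)` forces the point arms; (b) given the point arms
and uniqueness of the crossing clusters, `EVEN(z^δ) ↔ Patt`; (c) `EVEN2 ∩ CROSS ⊆ CROSS`;
(d) given the ball arms and uniqueness, `EVEN2 ∩ CROSS ↔ Patt`. -/
theorem stub_patternTransferDet : open Literature.Probability.LatticeModels Literature.Probability.Percolation Literature.Barriers.CriticalPhenomena Filter Topology in let E3:=EuclideanSpace ℝ (Fin 3); let μ : (L : ℕ)→MeasureTheory.Measure (BondConfig (BoxV 3 L)):=fun L=>rcMeasure (boxGraph 3 L) (fkIsingParam (criticalBeta 3)) 2 (boxBoundary 3 L); let PrL : (m : ℕ)→(Fin m→Set (Site 3))→Set (Fin m→Fin m→Prop)→ℕ→ℝ:=fun _ K R L=>(μ L).real {ω | (fun i j=>∃ x y : BoxV 3 L, x.1∈K i∧y.1∈K j∧(openGraph ω).Reachable x y)∈R}; let Pr : (m : ℕ)→(Fin m→Set (Site 3))→Set (Fin m→Fin m→Prop)→ℝ:=fun m K R=>limUnder atTop (PrL m K R); let mesh : ℝ→Site 3→E3:=fun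 δ z=>WithLp.toLp 2 fun i : Fin 3=>δ * (z i : ℝ); let disc : ℝ→Set E3→Set (Site 3):=fun δ A=>{x | mesh δ x∈A}; let EVEN : (n : ℕ)→Set (Fin n→Fin n→Prop):=fun n=>{R | ∀ i, Even ({j : Fin n | R i j}.ncard)}; let EVEN2 : (n : ℕ)→Set (Fin (n + n)→Fin (n + n)→Prop):=fun n=>{R | ∀ i : Fin n, Even ({j : Fin n | R (Fin.castAdd n i) (Fin.castAdd n j)}.ncard)}; let CROSS : (n : ℕ)→Set (Fin (n + n)→Fin (n + n)→Prop):=fun n=>{R | ∀ i : Fin n, R (Fin.castAdd n i) (Fin.natAdd n i)}; let pts : (n : ℕ)→ℝ→(Fin n→E3)→(Fin n→Set (Site 3)):=fun _ δ z j=>{latticeApprox δ (z j)}; let fam : (n : ℕ)→ℝ→(Fin n→Set E3)→(Fin n→Set E3)→(Fin (n + n)→Set (Site 3)):=fun _ δ A B=>Fin.append (fun j=>disc δ (A j)) (fun j=>disc δ (B j)); let Supp : (L : ℕ)→Set (BondConfig (BoxV 3 L)):=fun L=>{ω | ω ⊆ (boxGraph 3 L).edgeSet}; let Ev : (m : ℕ)→(Fin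 m→Set (Site 3))→Set (Fin m→Fin m→Prop)→(L : ℕ)→Set (BondConfig (BoxV 3 L)):=fun _ K R L=>{ω | (fun i j=>∃ x y : BoxV 3 L, x.1∈K i∧y.1∈K j∧(openGraph ω).Reachable x y)∈R}; let Out : (n : ℕ)→ℝ→(Fin n→E3)→(Fin n→ℝ)→(L : ℕ)→Set (BoxV 3 L):=fun _ δ b s L=>{x | ∀ k, mesh δ x.1 ∉ Metric.closedBall (b k) (s k)}; let RO : (L : ℕ)→BondConfig (BoxV 3 L)→Set (BoxV 3 L)→BoxV 3 L→BoxV 3 L→Prop:=fun L ω O x y=>(SimpleGraph.fromRel fun a a' : BoxV 3 L=>s(a, a')∈ω∧a∈O∧a'∈O).Reachable x y; let Crs : (n : ℕ)→ℝ→(Fin n→E3)→(Fin n→ℝ)→(Fin n→E3)→(Fin n→ℝ)→(L : ℕ)→BondConfig (BoxV 3 L)→Fin n→BoxV 3 L→Prop:=fun n δ c r b s L ω j x=>x∈Out n δ b s L∧(∃ y : BoxV 3 L, mesh δ y.1∈Metric.closedBall (b j) (s j)∧(boxGraph 3 L).Adj x y)∧(∃ y : BoxV 3 L, y∈Out n δ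 b s L∧mesh δ y.1∈(Metric.ball (c j) (r j))ᶜ∧RO L ω (Out n δ b s L) x y); let Uni : (n : ℕ)→ℝ→(Fin n→E3)→(Fin n→ℝ)→(Fin n→E3)→(Fin n→ℝ)→(L : ℕ)→Set (BondConfig (BoxV 3 L)):=fun n δ c r b s L=>{ω | ∀ (j : Fin n) (x x' : BoxV 3 L), Crs n δ c r b s L ω j x→Crs n δ c r b s L ω j x'→RO L ω (Out n δ b s L) x x'}; let Patt : (n : ℕ)→ℝ→(Fin n→E3)→(Fin n→ℝ)→(Fin n→E3)→(Fin n→ℝ)→(L : ℕ)→Set (BondConfig (BoxV 3 L)):=fun n δ c r b s L=>{ω | (fun i j=>∃ x x' : BoxV 3 L, Crs n δ c r b s L ω i x∧Crs n δ c r b s L ω j x'∧RO L ω (Out n δ b s L) x x')∈EVEN n}; ∀ (n : ℕ) (c : Fin n→E3) (r : Fin n→ℝ), (∀ j, 0 < r j)→(∀ j k, j ≠ k→Disjoint (Metric.closedBall (c j) (r j)) (Metric.closedBall (c k) (r k)))→∀ (b : Fin n→E3) (s : Fin n→ℝ), (∀ j, 0 < s j)→(∀ j, Metric.closedBall (b j)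 (s j) ⊆ Metric.ball (c j) (r j))→∃ δ₀ : ℝ, 0 < δ₀∧∀ δ : ℝ, 0 < δ→δ < δ₀→∀ z : Fin n→E3, (∀ j, z j∈Metric.ball (b j) (s j / 2))→∀ᶠ L in atTop, ∀ ω : BondConfig (BoxV 3 L), ω∈Supp L→(ω∈Ev n (pts n δ z) (EVEN n) L→ω∈Ev (n + n) (Fin.append (pts n δ z) (fun j=>disc δ (Metric.ball (c j) (r j))ᶜ)) (CROSS n) L)∧(ω∈Ev (n + n) (Fin.append (pts n δ z) (fun j=>disc δ (Metric.ball (c j) (r j))ᶜ)) (CROSS n) L→ω∈Uni n δ c r b s L→(ω∈Ev n (pts n δ z) (EVEN n) L ↔ ω∈Patt n δ c r b s L))∧(ω∈Ev (n + n) (fam n δ (fun j=>Metric.closedBall (b j) (s j)) (fun j=>(Metric.ball (c j) (r j))ᶜ)) (EVEN2 n ∩ CROSS n) L→ω∈Ev (n + n) (fam n δ (fun j=>Metric.closedBall (b j) (s j)) (fun j=>(Metric.ball (c j) (r j))ᶜ)) (CROSS n) L)∧(ω∈Ev (n + n) (fam n δ (fun j=>Metric.closedBall (b j) (s j)) (fun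 j=>(Metric.ball (c j) (r j))ᶜ)) (CROSS n) L→ω∈Uni n δ c r b s L→(ω∈Ev (n + n) (fam n δ (fun j=>Metric.closedBall (b j) (s j)) (fun j=>(Metric.ball (c j) (r j))ᶜ)) (EVEN2 n ∩ CROSS n) L ↔ ω∈Patt n δ c r b s L)) := by
  intro E3 μ PrL Pr mesh disc EVEN EVEN2 CROSS pts fam Supp Ev Out RO Crs Uni Patt n c r hr hd b s hs hin
  -- positive slack between each inner ball and its outer ball
  have hslack : ∀ j, ∃ e : ℝ, 0 < e ∧ cthickening e (closedBall (b j) (s j)) ⊆ ball (c j) (r j) :=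
    fun j => (isCompact_closedBall (b j) (s j)).exists_cthickening_subset_open isOpen_ball (hin j)
  choose e he hesub using hslack
  -- the mesh threshold
  obtain ⟨δ₀, hδ₀, hδ₀P⟩ : ∃ δ₀ : ℝ, 0 < δ₀ ∧ ∀ δ : ℝ, 0 < δ → δ < δ₀ →
      ∀ j, 2 * δ ≤ e j ∧ 4 * δ ≤ s j := by
    have hev : ∀ᶠ δ : ℝ in 𝓝 0, ∀ j, 2 * δ ≤ e j ∧ 4 * δ ≤ s j := by
      refine Filter.eventually_all.2 fun j => ?_
      have h1 : (0 : ℝ) < min (e j / 2) (s j / 4) :=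
        lt_min (by linarith [he j]) (by linarith [hs j])
      filter_upwards [eventually_lt_nhds h1] with δ hδ
      exact ⟨by linarith [min_le_left (e j / 2) (s j / 4)],
        by linarith [min_le_right (e j / 2) (s j / 4)]⟩
    obtain ⟨δ₀, hδ₀, h⟩ := Metric.eventually_nhds_iff.1 hev
    exact ⟨δ₀, hδ₀, fun δ hδ hδlt j => h (by rwa [Real.dist_eq, sub_zero, abs_of_pos hδ]) j⟩
  refine ⟨δ₀, hδ₀, fun δ hδ hδlt z hz => ?_⟩
  have hδj := hδ₀P δ hδ hδlt
  -- the lattice approximations of the points lie in the inner balls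
  have hPin : ∀ j, mesh δ (latticeApprox δ (z j)) ∈ closedBall (b j) (s j) := by
    intro j
    rw [mem_closedBall]
    have h1 : dist (mesh δ (latticeApprox δ (z j))) (z j) ≤ 2 * δ :=
      dist_mesh_latticeApprox_le hδ (z j)
    have h2 : dist (z j) (b j) < s j / 2 := mem_ball.1 (hz j)
    linarith [dist_triangle (mesh δ (latticeApprox δ (z j))) (z j) (b j), (hδj j).2]
  -- eventually in `L`, the points lie in the box
  have hbox : ∀ᶠ L : ℕ in atTop, ∀ i, latticeApprox δ (z i) ∈ box 3 L := by
    refine Filter.eventually_all.2 fun i => Filter.eventually_atTop.2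
      ⟨Finset.univ.sup fun k => (latticeApprox δ (z i) k).natAbs, fun L hL => ?_⟩
    rw [mem_box]
    intro k
    have hk : ((latticeApprox δ (z i) k).natAbs : ℤ) ≤ L := by
      have hkL : (latticeApprox δ (z i) k).natAbs ≤ L :=
        le_trans (Finset.le_sup (f := fun k => (latticeApprox δ (z i) k).natAbs)
          (Finset.mem_univ k)) hL
      exact_mod_cast hkL
    rw [Int.natCast_natAbs] at hk
    exact abs_le.1 hk
  filter_upwards [hbox] with L hL
  intro ω hω
  -- the generic excursion-decomposition framework on `BoxV 3 L`
  have hω' : ω ⊆ (boxGraph 3 L).edgeSet := hω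
  have hGH : openGraph ω ≤ boxGraph 3 L := fun a a' h =>
    (boxGraph 3 L).mem_edgeSet.1 (hω' ((openGraph_adj ω a a').1 h).1)
  have hRG : (SimpleGraph.fromRel fun a a' : BoxV 3 L =>
      s(a, a') ∈ ω ∧ a ∈ Out n δ b s L ∧ a' ∈ Out n δ b s L) ≤ openGraph ω := by
    intro a a' h
    rw [SimpleGraph.fromRel_adj] at h
    rw [openGraph_adj]
    rcases h with ⟨hne, h | h⟩
    · exact ⟨h.1, hne⟩
    · exact ⟨by rw [Sym2.eq_swap]; exact h.1, hne⟩
  have hR : ∀ ⦃a a' : BoxV 3 L⦄, (openGraph ω).Adj a a' → a ∈ Out n δ b s L →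
      a' ∈ Out n δ b s L → (SimpleGraph.fromRel fun a a' : BoxV 3 L =>
        s(a, a') ∈ ω ∧ a ∈ Out n δ b s L ∧ a' ∈ Out n δ b s L).Adj a a' :=
    fun a a' h ha ha' => (SimpleGraph.fromRel_adj _ _ _).2
      ⟨h.ne, Or.inl ⟨((openGraph_adj ω a a').1 h).1, ha, ha'⟩⟩
  have hO : ∀ x : BoxV 3 L, x ∈ Out n δ b s L ↔
      ∀ k, x ∉ (fun k => {x : BoxV 3 L | mesh δ x.1 ∈ closedBall (b k) (s k)}) k :=
    fun x => Iff.rfl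
  have hIF : ∀ (k : Fin n) (x : BoxV 3 L),
      x ∈ (fun k => {x : BoxV 3 L | mesh δ x.1 ∈ closedBall (b k) (s k)}) k →
      x ∈ (fun k => {x : BoxV 3 L | mesh δ x.1 ∈ (ball (c k) (r k))ᶜ}) k → False :=
    fun k x hx hF => hF (hin k hx)
  have hfar : ∀ ⦃k m : Fin n⦄, k ≠ m →
      (fun k => {x : BoxV 3 L | mesh δ x.1 ∈ closedBall (b k) (s k)}) m ⊆
      (fun k => {x : BoxV 3 L | mesh δ x.1 ∈ (ball (c k) (r k))ᶜ}) k :=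
    fun k m hkm x hx => not_mem_ball_of_mem_inner hx (hin m) (hd m k (Ne.symm hkm))
  have hrim : ∀ ⦃k m : Fin n⦄, k ≠ m → ∀ ⦃x y : BoxV 3 L⦄, (boxGraph 3 L).Adj x y →
      y ∈ (fun k => {x : BoxV 3 L | mesh δ x.1 ∈ closedBall (b k) (s k)}) m →
      x ∈ (fun k => {x : BoxV 3 L | mesh δ x.1 ∈ (ball (c k) (r k))ᶜ}) k :=
    fun k m hkm x y hxy hy => not_mem_ball_of_near_inner hy (dist_mesh_le_of_adj hδ.le hxy)
      (hδj m).1 (hesub m) (hd m k (Ne.symm hkm))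
  have hCrs : ∀ (k : Fin n) (x : BoxV 3 L), Crs n δ c r b s L ω k x ↔
      x ∈ Out n δ b s L ∧
      (∃ y, y ∈ (fun k => {x : BoxV 3 L | mesh δ x.1 ∈ closedBall (b k) (s k)}) k ∧
        (boxGraph 3 L).Adj x y) ∧
      ∃ y, y ∈ Out n δ b s L ∧ y ∈ (fun k => {x : BoxV 3 L | mesh δ x.1 ∈ (ball (c k) (r k))ᶜ}) k ∧
        (SimpleGraph.fromRel fun a a' : BoxV 3 L =>
          s(a, a') ∈ ω ∧ a ∈ Out n δ b s L ∧ a' ∈ Out n δ b s L).Reachable x y :=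
    fun k x => Iff.rfl
  -- the points as box vertices
  let P : Fin n → BoxV 3 L := fun i => ⟨latticeApprox δ (z i), hL i⟩
  have hP : ∀ k, P k ∈ (fun k => {x : BoxV 3 L | mesh δ x.1 ∈ closedBall (b k) (s k)}) k :=
    fun k => hPin k
  have hRE : ∀ i j, (∃ x y : BoxV 3 L, x.1 ∈ pts n δ z i ∧ y.1 ∈ pts n δ z j ∧
      (openGraph ω).Reachable x y) ↔ (openGraph ω).Reachable (P i) (P j) := by
    intro i j
    constructor
    · rintro ⟨⟨x, hxm⟩, ⟨y, hym⟩, hx, hy, h⟩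
      change x = latticeApprox δ (z i) at hx
      change y = latticeApprox δ (z j) at hy
      subst hx hy
      exact h
    · exact fun h => ⟨P i, P j, rfl, rfl, h⟩
  refine ⟨?_, ?_, fun h => h.2, ?_⟩
  · -- (a) the point pattern forces the point arms
    intro hE i
    have hEi : Even ({j : Fin n | ∃ x y : BoxV 3 L, x.1 ∈ pts n δ z i ∧ y.1 ∈ pts n δ z j ∧
        (openGraph ω).Reachable x y}.ncard) := hE i
    obtain ⟨j, hj, hji⟩ : ∃ j, (openGraph ω).Reachable (P i) (P j) ∧ j ≠ i := by
      by_contra hcon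
      push Not at hcon
      have hset : {j : Fin n | ∃ x y : BoxV 3 L, x.1 ∈ pts n δ z i ∧ y.1 ∈ pts n δ z j ∧
          (openGraph ω).Reachable x y} = {i} := by
        ext j
        simp only [Set.mem_setOf_eq, Set.mem_singleton_iff, hRE]
        exact ⟨hcon j, fun h => h ▸ SimpleGraph.Reachable.refl _⟩
      rw [hset, Set.ncard_singleton] at hEi
      exact Nat.not_even_one hEi
    refine ⟨P i, P j, ?_, ?_, hj⟩
    · show (P i).1 ∈ Fin.append (pts n δ z) (fun j => disc δ (ball (c j) (r j))ᶜ) (Fin.castAdd n i)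
      rw [Fin.append_left]
      rfl
    · show (P j).1 ∈ Fin.append (pts n δ z) (fun j => disc δ (ball (c j) (r j))ᶜ) (Fin.natAdd n i)
      rw [Fin.append_right]
      exact hfar (Ne.symm hji) (hP j)
  · -- (b) given the point arms and uniqueness, point pattern = crossing-cluster pattern
    intro hA huni
    have harm : ∀ k, ∃ y, y ∈ (fun k => {x : BoxV 3 L | mesh δ x.1 ∈ (ball (c k) (r k))ᶜ}) k ∧
        (openGraph ω).Reachable (P k) y := by
      intro k
      obtain ⟨x, y, hx, hy, hxy⟩ := hA k
      rw [Fin.append_left] at hx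
      rw [Fin.append_right] at hy
      obtain ⟨x, hxm⟩ := x
      change x = latticeApprox δ (z k) at hx
      subst hx
      exact ⟨y, hy, hxy⟩
    have key : ∀ i j, (∃ x y : BoxV 3 L, x.1 ∈ pts n δ z i ∧ y.1 ∈ pts n δ z j ∧
        (openGraph ω).Reachable x y) ↔ ∃ x x' : BoxV 3 L, Crs n δ c r b s L ω i x ∧
          Crs n δ c r b s L ω j x' ∧ RO L ω (Out n δ b s L) x x' := fun i j =>
      (hRE i j).trans (reachable_points_iff_crs hGH hRG hR hO hIF hfar hrim hCrs huni P hP harm i j)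
    exact mem_iff_mem_of_forall_iff key (EVEN n)
  · -- (d) given the ball arms and uniqueness, ball pattern = crossing-cluster pattern
    intro hB huni
    have happL : ∀ i, fam n δ (fun j => closedBall (b j) (s j)) (fun j => (ball (c j) (r j))ᶜ)
        (Fin.castAdd n i) = disc δ (closedBall (b i) (s i)) := fun i => Fin.append_left _ _ i
    have happR : ∀ i, fam n δ (fun j => closedBall (b j) (s j)) (fun j => (ball (c j) (r j))ᶜ)
        (Fin.natAdd n i) = disc δ (ball (c i) (r i))ᶜ := fun i => Fin.append_right _ _ i
    have harm : ∀ k, ∃ x y : BoxV 3 L,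
        x ∈ (fun k => {x : BoxV 3 L | mesh δ x.1 ∈ closedBall (b k) (s k)}) k ∧
        y ∈ (fun k => {x : BoxV 3 L | mesh δ x.1 ∈ (ball (c k) (r k))ᶜ}) k ∧
        (openGraph ω).Reachable x y := by
      intro k
      obtain ⟨x, y, hx, hy, hxy⟩ := hB k
      rw [happL] at hx
      rw [happR] at hy
      exact ⟨x, y, hx, hy, hxy⟩
    have key : ∀ i j, (∃ x y : BoxV 3 L,
        x.1 ∈ fam n δ (fun j => closedBall (b j) (s j)) (fun j => (ball (c j) (r j))ᶜ)
          (Fin.castAdd n i) ∧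
        y.1 ∈ fam n δ (fun j => closedBall (b j) (s j)) (fun j => (ball (c j) (r j))ᶜ)
          (Fin.castAdd n j) ∧ (openGraph ω).Reachable x y) ↔
        ∃ x x' : BoxV 3 L, Crs n δ c r b s L ω i x ∧
          Crs n δ c r b s L ω j x' ∧ RO L ω (Out n δ b s L) x x' := by
      intro i j
      rw [happL i, happL j]
      exact reachable_inner_iff_crs hGH hRG hR hO hIF hfar hrim hCrs huni harm i j
    exact mem_even2_iff_of_forall_iff key hB

end Summit.CriticalPhenomena.Ising3DConformalLimit.Theorems.EvenPatternDecoupling
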